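import Summits.BirchSwinnertonDyer.BirchSwinnertonDyer.Theorems.SignedLowerHalvesSmallImageLowerHalfBothSignsRttRecipMTHeckeLValues
import HarnessLib

/-!
# S4″ θ-side: the depletion ideal `𝔣'` EXISTS from the frame's pin alone (`Ram(θ) ⊆ supp(p𝔪)`), and the `𝔣'`-free package

Summit `BirchSwinnertonDyer`, crux `SmallImageLowerHalfBothSigns` (stmt-23599), line `rtt_w3`, stub S4‴ `stub_junctionRecipValues_ns`, «recip-an» half.
Namespace `…Theorems.SmallImageRttReciprocity`. THEOREMS ONLY.

`twistedLSeries_conj_eq_rayClassLSeries` / `exists_period_transport_rayClass` (p825887 / p825997) take an ideal `𝔣' ≠ 0` with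
`𝔣' ∣ 𝔭_w ⟺ (p ∈ 𝔭_w ∨ θ ramified at w)`. Such an ideal exists as soon as `θ` is unramified off `p𝔪` — which the frame's pinning
hypothesis `hθ` provides — namely `𝔣' = ∏ {𝔭_w : w ∣ p𝔪, p ∈ 𝔭_w ∨ θ ramified at w}` (prime avoidance in the Dedekind domain `𝓞_K`).

* `exists_depletionIdeal` — `∃ 𝔣' ≠ ⊥, ∀ w, 𝔣' ≤ 𝔭_w ↔ (p ∈ 𝔭_w ∨ ¬ θ unramified at w)` from `∀ w ∤ p𝔪, θ unramified at w`.
* `exists_period_transport_rayClass'` — the package of `exists_period_transport_rayClass` with `𝔣'` produced inside (no `𝔣'` binder).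

References: [NeukirchANT1999] Ch. I §3 (3.3); [MazurTateTeitelbaum1986Invent] §I.8; [Ribet1977Nebentypus] §3.
-/

-- the Theorems namespace of this sub repeats the summit name by design (D-0017 nested layout)
set_option linter.dupNamespace false

noncomputable section

open scoped Classical MatrixGroups ModularForm NumberField
open Polynomial CongruenceSubgroup NumberField IsDedekindDomain
  Literature.NumberTheory.GaloisRepresentations Literature.NumberTheory.LFunctions Literature.NumberTheory.Automorphic
  Literature.NumberTheory.EllipticCurves Literature.NumberTheory.EllipticCurves.ModularForms

namespace Summit.BirchSwinnertonDyer.BirchSwinnertonDyer.Theorems.SmallImageRttReciprocity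

variable {p : ℕ} [Fact p.Prime] {K : Type} [Field K] [NumberField K]

/-- **The depletion ideal.** If the rank-one representation `θ` is unramified at every place `w ∤ p𝔪` (`𝔪 ≠ 0`), then there is a nonzero
ideal `𝔣'` of `𝓞_K` dividing exactly the primes `𝔭_w` with `p ∈ 𝔭_w` or `θ` ramified at `w`: the product of these finitely many primes
(all of them divide `p𝔪`), by prime avoidance. [cite: NeukirchANT1999, Ch. I §3 (3.3)] -/
theorem exists_depletionIdeal {A : Type*} [CommRing A] [TopologicalSpace A] (θ : FramedGaloisRep K A 1) {𝔪 : Ideal (𝓞 K)} (h𝔪 : 𝔪 ≠ ⊥)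
    (hunr : ∀ w : HeightOneSpectrum (𝓞 K), ((p : ℕ) : 𝓞 K) ∉ w.asIdeal → ¬ 𝔪 ≤ w.asIdeal → θ.IsUnramifiedAt w) :
    ∃ 𝔣' : Ideal (𝓞 K), 𝔣' ≠ ⊥ ∧
      ∀ w : HeightOneSpectrum (𝓞 K), 𝔣' ≤ w.asIdeal ↔ (((p : ℕ) : 𝓞 K) ∈ w.asIdeal ∨ ¬ θ.IsUnramifiedAt w) := by
  -- the bad set is contained in the primes of `p𝔪`, a finite set
  have hp0 : ((p : ℕ) : 𝓞 K) ≠ 0 := by exact_mod_cast (Fact.out : p.Prime).ne_zero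
  have hpm : Ideal.span {((p : ℕ) : 𝓞 K)} * 𝔪 ≠ ⊥ :=
    mul_ne_zero (mt Ideal.span_singleton_eq_bot.mp hp0) h𝔪
  have hfin : {w : HeightOneSpectrum (𝓞 K) | ((p : ℕ) : 𝓞 K) ∈ w.asIdeal ∨ ¬ θ.IsUnramifiedAt w}.Finite := by
    refine (Ideal.finite_factors hpm).subset fun w hw ↦ ?_
    have hdvd : w.asIdeal ∣ Ideal.span {((p : ℕ) : 𝓞 K)} * 𝔪 := by
      by_cases hpw : ((p : ℕ) : 𝓞 K) ∈ w.asIdeal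
      · exact dvd_mul_of_dvd_left (Ideal.dvd_iff_le.mpr ((Ideal.span_singleton_le_iff_mem _).mpr hpw)) _
      · by_cases h𝔪w : 𝔪 ≤ w.asIdeal
        · exact dvd_mul_of_dvd_right (Ideal.dvd_iff_le.mpr h𝔪w) _
        · exact absurd (hunr w hpw h𝔪w) (hw.resolve_left hpw)
    exact hdvd
  refine ⟨∏ w ∈ hfin.toFinset, w.asIdeal, ?_, fun w ↦ ?_⟩
  · rw [Ne, ← Ideal.zero_eq_bot, Finset.prod_eq_zero_iff]
    rintro ⟨w, -, hw⟩
    exact w.ne_bot (hw.trans Ideal.zero_eq_bot)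
  · rw [Ideal.IsPrime.prod_le w.isPrime]
    constructor
    · rintro ⟨w', hw', hle⟩
      have heq : w' = w := by
        haveI := w'.isMaximal
        exact HeightOneSpectrum.ext (Ideal.IsMaximal.eq_of_le inferInstance w.isPrime.ne_top hle)
      exact heq ▸ (hfin.mem_toFinset.mp hw')
    · intro hw
      exact ⟨w, hfin.mem_toFinset.mpr hw, le_rfl⟩

/-- ★★ **The θ-side package WITHOUT the `𝔣'` binder**: for the S4″ frame data, the print input `hBad`, any Frobenius choice `φ` and a plus
period `Ω` of `g`, there are the depletion ideal `𝔣'` (`exists_depletionIdeal`, from the pin `hθ`), the complex conjugate newform `g'`, the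
transported period `Ω′`, and — for every primitive `p^{n+1}`-th root of unity `ζ ∈ ℚ̄_p` — the character `χ_ζ` with the Dirichlet-series identity
and the value formula of `exists_period_transport_rayClass`. [cite: MazurTateTeitelbaum1986Invent, §I.8 (8.6) and §I.13]
[cite: Ribet1977Nebentypus, §3 Cor. (3.5)] [cite: Shimura1977, Thm. 1] -/
theorem exists_period_transport_rayClass' (K : Type) [Field K] [NumberField K] (hK2 : Module.finrank ℚ K = 2) (htc : IsTotallyComplex K)
    (σK : K →+* ℂ) (𝔪 : Ideal (𝓞 K)) (h𝔪 : 𝔪 ≠ ⊥) (ψ : HeightOneSpectrum (𝓞 K) → ℂ) (hψ : IsGrossencharakter 𝔪 (embType σK) (embTypeConj σK) ψ)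
    (hψpow : ∀ n : ℕ, Odd n → n.Coprime ((discr K).natAbs * Ideal.absNorm 𝔪) →
      idealPow K ψ (Ideal.span {(n : 𝓞 K)}) = (jacobiSym (discr K) n : ℂ) * (n : ℂ) ^ (2 - 1))
    (e : PadicAlgCl p ≃+* ℂ) {M : ℕ} [NeZero M] (g : CuspForm (Gamma0 M) 2) (ι : coeffField g →+* PadicAlgCl p) (hng : IsNewform0 g)
    (hcoeffψ : ∀ ℓ : ℕ, ℓ.Prime → ¬ ℓ ∣ (discr K).natAbs * Ideal.absNorm 𝔪 →
      embCoeff g ι ℓ = e.symm (∑ᶠ (w : HeightOneSpectrum (𝓞 K)) (_ : Ideal.absNorm w.asIdeal = ℓ), ψ w))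
    (S : Set (PadicAlgCl p)) (θ : FramedGaloisRep K (padicCoeffIntegers S) 1)
    (hθ : ∀ w : HeightOneSpectrum (𝓞 K), ((p : ℕ) : 𝓞 K) ∉ w.asIdeal → ¬ 𝔪 ≤ w.asIdeal →
      θ.IsUnramifiedAt w ∧ ∃ P : Polynomial (padicCoeffIntegers S), P.map (padicCoeffIntegers S).subtype = X - C (e.symm (ψ w)) ∧ θ.HasFrobCharpolyAt w P)
    (hBad : Ribet1977_cmNewform_gamma0_badEulerFactor_padicCharacter)
    (φ : HeightOneSpectrum (𝓞 K) → Field.absoluteGaloisGroup K) (hφ : ∀ w : HeightOneSpectrum (𝓞 K), ∃ 𝔓 ∈ w.primesAbove, IsArithFrobAt (𝓞 K) (φ w) 𝔓)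
    (Ω : ℂ) (hΩ : IsPlusPeriod g Ω) :
    ∃ (𝔣' : Ideal (𝓞 K)) (g' : CuspForm (Gamma0 M) 2) (Ω' : ℂ), 𝔣' ≠ ⊥ ∧
      (∀ w : HeightOneSpectrum (𝓞 K), 𝔣' ≤ w.asIdeal ↔ (((p : ℕ) : 𝓞 K) ∈ w.asIdeal ∨ ¬ θ.IsUnramifiedAt w)) ∧
      IsNewform0 g' ∧ Ω' ≠ 0 ∧
      (∀ n : ℕ, cuspCoeff g' n = e (ι ⟨cuspCoeff g n, coeff_mem_coeffField g n⟩)) ∧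
      (∀ r : ℚ, plusSymbol g' r = Ω' * e (ι (plusSymbolK g Ω r))) ∧
      (∀ {L : ℂ → ℂ}, Differentiable ℂ L → (∀ s : ℂ, 2 < s.re → L s = cuspFormLSeries g' s) → Ω' * e (ι (plusSymbolK g Ω 0)) = L 1) ∧
      ∀ (n : ℕ) (ζ : PadicAlgCl p), IsPrimitiveRoot ζ (p ^ (n + 1)) →
        ∃ χ : DirichletCharacter ℂ (p ^ (n + 1 + cyclotomicExponent p)), χ.IsPrimitive ∧ χ.Even ∧ (∃ i : ℕ, orderOf χ = p ^ i) ∧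
          χ (cyclotomicGenerator p : ZMod (p ^ (n + 1 + cyclotomicExponent p))) = e ζ ∧
          (∃ σ₀ : ℝ, 2 ≤ σ₀ ∧ ∀ s : ℂ, σ₀ < s.re → twistedLSeries g' χ⁻¹ s =
            rayClassLSeries 𝔣' (fun w : HeightOneSpectrum (𝓞 K) ↦
              e ((((θ (φ w) : GL (Fin 1) (padicCoeffIntegers S)) : Matrix (Fin 1) (Fin 1) (padicCoeffIntegers S)) 0 0 : padicCoeffIntegers S) :
                PadicAlgCl p) * χ⁻¹ ((Ideal.absNorm w.asIdeal : ℕ) : ZMod (p ^ (n + 1 + cyclotomicExponent p)))) s) ∧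
          ∀ {Λ : ℂ → ℂ}, Differentiable ℂ Λ →
            (∃ σ₁ : ℝ, ∀ s : ℂ, σ₁ < s.re → Λ s =
              rayClassLSeries 𝔣' (fun w : HeightOneSpectrum (𝓞 K) ↦
                e ((((θ (φ w) : GL (Fin 1) (padicCoeffIntegers S)) : Matrix (Fin 1) (Fin 1) (padicCoeffIntegers S)) 0 0 : padicCoeffIntegers S) :
                  PadicAlgCl p) * χ⁻¹ ((Ideal.absNorm w.asIdeal : ℕ) : ZMod (p ^ (n + 1 + cyclotomicExponent p)))) s) →
            Ω' * e ((mazurTateElementK g Ω p (n + 1)).eval₂ ι (ζ - 1)) =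
              gaussSum χ (ZMod.stdAddChar (N := p ^ (n + 1 + cyclotomicExponent p))) * Λ 1 := by
  obtain ⟨𝔣', h𝔣'0, h𝔣'⟩ := exists_depletionIdeal (p := p) θ h𝔪 fun w hpw h𝔪w ↦ (hθ w hpw h𝔪w).1
  obtain ⟨g', Ω', h⟩ := exists_period_transport_rayClass K hK2 htc σK 𝔪 h𝔪 ψ hψ hψpow e g ι hng hcoeffψ S θ hθ hBad φ hφ 𝔣' h𝔣'0 h𝔣' Ω hΩ
  exact ⟨𝔣', g', Ω', h𝔣'0, h𝔣', h⟩

end Summit.BirchSwinnertonDyer.BirchSwinnertonDyer.Theorems.SmallImageRttReciprocity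

end
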